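import Literature.NumberTheory.ComplexMultiplication.CMTypeRankPartition
import HarnessLib

/-!
# The pairwise criterion BETWEEN BLOCKS follows from the pairwise criterion between SLOTS OF DIFFERENT BLOCKS

Companion of `NumberTheory/ComplexMultiplication/CMTypeRankPartition` (a family `Φ_i ⊆ E_i` of CM types for a
conjugation `ρ ∈ G`, grouped into blocks along `κ : I → C`; if for all blocks `c ≠ c'` the `G`-modules `U(Σ|_c)`,
`U(Σ|_{c'})` — the antisymmetric spans of the block sub-families — have NO COMMON CONSTITUENT, then
`rank(Σ) + |C| = Σ_c rank(Σ|_c) + 1`, i.e. `Hg(∏_i A_i) = ∏_c Hg(∏_{κ i = c} A_i)`, and `Σ` is nondegenerate iff every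
block sub-family is) and of `…/CMTypeRankCommonConstituent` (the same criterion between single slots).  The block
hypothesis lives on the modules `U(Σ|_c) ≤ ⊕_{κ i = c} U(Φ_i)`, which one does not want to compute.  Here it is
REDUCED TO THE SLOTS:

> **Theorem** (`pairwise_fiber_of_pairwise_slots`).  If for every ordered pair of slots `i, j` in DIFFERENT blocks
> (`κ i ≠ κ j`) the modules `U(Φ_i)`, `U(Φ_j)` have no common constituent (every `G`-stable `P ≤ U(Φ_i)` carrying a
> linear `T : ℚ^{E_i} → ℚ^{E_j}`, equivariant and injective on `P`, with `T(P) ≤ U(Φ_j)`, is zero), then for all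
> blocks `c ≠ c'` the modules `U(Σ|_c)`, `U(Σ|_{c'})` have no common constituent.

Hence (`typeRank_sigmaType_add_card_eq_of_pairwise_slots_fiber`,
`typeRank_sigmaType_eq_iff_forall_fiber_of_pairwise_slots`): **under the slot criterion ACROSS blocks — nothing at
all is asked of two slots in the same block — `rank(Σ) + |C| = Σ_c rank(Σ|_c) + 1` and `Σ` is nondegenerate iff
every block sub-family `Σ|_c` is.**  This is the form in which products of simple CM abelian varieties are sorted:
slots sharing all their constituents (a quartic CM field and its reflex field; the isogeny classes of one sextic CM
field; twin sextic fields) go into one block, decided by a block theorem, and every cross-block pair of slots is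
settled by one of the slot criteria (`pairwise_of_partialConj`, `pairwise_of_eigenvector`,
`pairwise_of_irreducible_of_finrank_le`, …), however the blocks overlap in their Galois closures.

PROOF.  Let `P ≤ U(Σ|_c)` be stable and non-zero with an equivariant `T` injective on `P` into `U(Σ|_{c'})`.  A
MINIMAL non-zero stable `P₀ ≤ P` exists (finite dimension).  By minimality every slot restriction `p_i` (`κ i = c`)
is zero or injective on `P₀`, and so is every `p_j ∘ T` (`κ j = c'`); some `p_i` and some `p_j ∘ T` are injective
(a weight all of whose slot restrictions vanish is zero; `T` is injective on `P₀`).  Then `P_i = p_i(P₀) ≤ U(Φ_i)`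
(slot restrictions map `U(Σ|_c)` into `U(Φ_i)`, `map_funLeft_mk_antiSpan_sigmaType`) is stable and non-zero, and
`p_j ∘ T ∘ (p_i|_{P₀})⁻¹`, extended linearly to `ℚ^{E_i}`, is equivariant and injective on `P_i` with values in
`p_j(U(Σ|_{c'})) = U(Φ_j)` — a common constituent of `U(Φ_i)` and `U(Φ_j)` with `κ i = c ≠ c' = κ j`, excluded.

Everything is finite-dimensional linear algebra over `ℚ`; theorems only, no definition, no named fact, no `sorry`.
On Hodge groups ([Deligne1982HodgeCycles] I Ex. 3.7 (c); [MoonenZarhin1999LowDim] §3 (3.1)): if no simple factor of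
`Hg(A_i)`'s character module is shared with `Hg(A_j)`'s whenever `A_i`, `A_j` lie in different blocks, then
`Hg(∏_i A_i) = ∏_c Hg(∏_{block c} A_i)`.

## References
* [Gordon1999HodgeAVSurvey] B. B. Gordon, *A survey of the Hodge conjecture for abelian varieties*, §3 Theorem (Imai,
  Murty) with proof; 7.5–7.7.
* [MoonenZarhin1999LowDim] B. Moonen, Yu. Zarhin, Math. Ann. 315 (1999) 711–733, §3 (3.1), Remark (3.9).
* [Deligne1982HodgeCycles] P. Deligne, *Hodge cycles on abelian varieties*, LNM 900 (1982), I Ex. 3.7.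
* [Serre1977] J.-P. Serre, *Linear Representations of Finite Groups*, GTM 42, §1.3–§2.2.
-/

set_option autoImplicit false

noncomputable section

open scoped BigOperators

namespace Literature.NumberTheory.ComplexMultiplication

variable {G : Type*} [Group G] {I : Type*} {E : I → Type*} [∀ i, MulAction G (E i)] {C : Type*}

/-! ### A minimal stable subspace -/

section Minimal

variable {X : Type*} [MulAction G X] [Fintype X]

/-- A non-zero `G`-stable subspace of `ℚ^X` contains a MINIMAL non-zero `G`-stable subspace (finite dimension; no
complete reducibility is used). [cite: Serre1977, §1.3] -/
private theorem exists_minimal_stable' {C₀ : Submodule ℚ (X → ℚ)} (hC : C₀ ≠ ⊥)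
    (hCst : ∀ g : G, ∀ f ∈ C₀, (fun x => f (g • x)) ∈ C₀) :
    ∃ P : Submodule ℚ (X → ℚ), P ≤ C₀ ∧ P ≠ ⊥ ∧ (∀ g : G, ∀ f ∈ P, (fun x => f (g • x)) ∈ P) ∧
      ∀ P' : Submodule ℚ (X → ℚ), P' ≤ P → P' ≠ ⊥ → (∀ g : G, ∀ f ∈ P', (fun x => f (g • x)) ∈ P') → P' = P := by
  classical
  have hex : ∃ n, ∃ P : Submodule ℚ (X → ℚ), P ≤ C₀ ∧ P ≠ ⊥ ∧
      (∀ g : G, ∀ f ∈ P, (fun x => f (g • x)) ∈ P) ∧ Module.finrank ℚ P = n :=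
    ⟨_, C₀, le_rfl, hC, hCst, rfl⟩
  obtain ⟨P, hPC, hP0, hPst, hPn⟩ := Nat.find_spec hex
  refine ⟨P, hPC, hP0, hPst, fun P' hP'P hP'0 hP'st => ?_⟩
  have hmin := Nat.find_min' hex ⟨P', hP'P.trans hPC, hP'0, hP'st, rfl⟩
  exact Submodule.eq_of_le_of_finrank_eq hP'P (le_antisymm (Submodule.finrank_mono hP'P) (hPn ▸ hmin))

omit [Fintype X] in
/-- In a minimal non-zero stable subspace `P`, an equivariant linear map is ZERO OR INJECTIVE on `P` (its kernel
meets `P` in a stable subspace). [cite: Serre1977, §2.2 Prop. 4 (proof)] -/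
private theorem forall_eq_zero_or_injOn_of_minimal {Y : Type*} [MulAction G Y] {P : Submodule ℚ (X → ℚ)}
    (hPst : ∀ g : G, ∀ f ∈ P, (fun x => f (g • x)) ∈ P)
    (hPmin : ∀ P' : Submodule ℚ (X → ℚ), P' ≤ P → P' ≠ ⊥ →
      (∀ g : G, ∀ f ∈ P', (fun x => f (g • x)) ∈ P') → P' = P)
    (S : (X → ℚ) →ₗ[ℚ] (Y → ℚ)) (hS : ∀ g : G, ∀ f ∈ P, S (fun x => f (g • x)) = fun y => S f (g • y)) :
    (∀ f ∈ P, S f = 0) ∨ ∀ f ∈ P, S f = 0 → f = 0 := by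
  by_cases hK : P ⊓ LinearMap.ker S = ⊥
  · refine Or.inr fun f hf hf0 => ?_
    have : f ∈ P ⊓ LinearMap.ker S := ⟨hf, LinearMap.mem_ker.2 hf0⟩
    rw [hK] at this
    exact (Submodule.mem_bot ℚ).1 this
  · refine Or.inl fun f hf => ?_
    have hKst : ∀ g : G, ∀ f ∈ P ⊓ LinearMap.ker S, (fun x => f (g • x)) ∈ P ⊓ LinearMap.ker S :=
      fun g f hf => Submodule.mem_inf.2 ⟨hPst g f (Submodule.mem_inf.1 hf).1, by
        have h0 : S f = 0 := LinearMap.mem_ker.1 (Submodule.mem_inf.1 hf).2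
        rw [LinearMap.mem_ker, hS g f (Submodule.mem_inf.1 hf).1, h0]
        rfl⟩
    have hKP := hPmin _ inf_le_left hK hKst
    have : f ∈ P ⊓ LinearMap.ker S := by rw [hKP]; exact hf
    exact LinearMap.mem_ker.1 this.2

end Minimal

/-! ### From slots to blocks -/

section SlotsToBlocks

variable [Fintype I] [DecidableEq C] [∀ i, Fintype (E i)]

/-- **The pairwise criterion between slots of different blocks gives the pairwise criterion between blocks.**  If for
all slots `i, j` with `κ i ≠ κ j` every `G`-stable `P ≤ U(Φ_i)` admitting a linear map `T : ℚ^{E_i} → ℚ^{E_j}` which is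
equivariant on `P`, maps `P` into `U(Φ_j)` and is injective on `P` is zero, then the same holds for the antisymmetric
spans `U(Σ|_c)`, `U(Σ|_{c'})` of the block sub-families of any two distinct blocks `c ≠ c'` (a minimal stable
`P₀ ≤ P` restricts injectively to some slot `i` of `c`, its image restricts injectively to some slot `j` of `c'`).
[cite: Serre1977, §2.2 Prop. 4 (proof)] [cite: Gordon1999HodgeAVSurvey, §3 Theorem (proof)] -/
theorem pairwise_fiber_of_pairwise_slots {Φ : ∀ i, Set (E i)} (κ : I → C)
    (hpair : ∀ i j, κ i ≠ κ j → ∀ P : Submodule ℚ (E i → ℚ), P ≤ antiSpan G (Φ i) →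
      (∀ g : G, ∀ f ∈ P, (fun x => f (g • x)) ∈ P) →
      ∀ T : (E i → ℚ) →ₗ[ℚ] (E j → ℚ),
        (∀ g : G, ∀ f ∈ P, T (fun x => f (g • x)) = fun y => T f (g • y)) →
        (∀ f ∈ P, T f ∈ antiSpan G (Φ j)) → (∀ f ∈ P, T f = 0 → f = 0) → P = ⊥) :
    ∀ c c', c ≠ c' → ∀ P : Submodule ℚ ((Σ i : {i // κ i = c}, E i.1) → ℚ),
      P ≤ antiSpan G (sigmaType fun i : {i // κ i = c} => Φ i.1) →
      (∀ g : G, ∀ f ∈ P, (fun x => f (g • x)) ∈ P) →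
      ∀ T : ((Σ i : {i // κ i = c}, E i.1) → ℚ) →ₗ[ℚ] ((Σ i : {i // κ i = c'}, E i.1) → ℚ),
        (∀ g : G, ∀ f ∈ P, T (fun x => f (g • x)) = fun y => T f (g • y)) →
        (∀ f ∈ P, T f ∈ antiSpan G (sigmaType fun i : {i // κ i = c'} => Φ i.1)) →
        (∀ f ∈ P, T f = 0 → f = 0) → P = ⊥ := by
  classical
  intro c c' hcc' P hP hPst T hT hTU hTinj
  by_contra hP0
  -- a minimal non-zero stable `P₀ ≤ P`
  obtain ⟨P₀, hP₀P, hP₀0, hP₀st, hP₀min⟩ := exists_minimal_stable' (G := G) hP0 hPst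
  -- slot restrictions of the two blocks
  let p : ∀ i : {i // κ i = c}, ((Σ i : {i // κ i = c}, E i.1) → ℚ) →ₗ[ℚ] (E i.1 → ℚ) :=
    fun i => LinearMap.funLeft ℚ ℚ (@Sigma.mk _ (fun i' : {i // κ i = c} => E i'.1) i)
  let q : ∀ j : {j // κ j = c'}, ((Σ j : {j // κ j = c'}, E j.1) → ℚ) →ₗ[ℚ] (E j.1 → ℚ) :=
    fun j => LinearMap.funLeft ℚ ℚ (@Sigma.mk _ (fun j' : {j // κ j = c'} => E j'.1) j)
  have hpg : ∀ (i) (f : (Σ i : {i // κ i = c}, E i.1) → ℚ) (g : G),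
      p i (fun x => f (g • x)) = fun s => p i f (g • s) := fun _ _ _ => rfl
  have hqg : ∀ (j) (f : (Σ j : {j // κ j = c'}, E j.1) → ℚ) (g : G),
      q j (fun x => f (g • x)) = fun s => q j f (g • s) := fun _ _ _ => rfl
  -- `p_i(U(Σ|_c)) = U(Φ_i)`, `q_j(U(Σ|_{c'})) = U(Φ_j)`
  have hpU : ∀ i, ∀ f ∈ antiSpan G (sigmaType fun i : {i // κ i = c} => Φ i.1), p i f ∈ antiSpan G (Φ i.1) :=
    fun i f hf => by
      rw [← map_funLeft_mk_antiSpan_sigmaType (fun i : {i // κ i = c} => Φ i.1) i]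
      exact ⟨f, hf, rfl⟩
  have hqU : ∀ j, ∀ f ∈ antiSpan G (sigmaType fun j : {j // κ j = c'} => Φ j.1), q j f ∈ antiSpan G (Φ j.1) :=
    fun j f hf => by
      rw [← map_funLeft_mk_antiSpan_sigmaType (fun j : {j // κ j = c'} => Φ j.1) j]
      exact ⟨f, hf, rfl⟩
  -- a non-zero `f₀ ∈ P₀` and a slot `i` of `c` with `p_i f₀ ≠ 0`
  obtain ⟨f₀, hf₀, hf₀0⟩ := (Submodule.ne_bot_iff P₀).1 hP₀0
  have hex_i : ∃ i, p i f₀ ≠ 0 := by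
    by_contra hall
    apply hf₀0
    funext x
    obtain ⟨i, s⟩ := x
    have h0 : p i f₀ = 0 := not_not.1 fun hne => hall ⟨i, hne⟩
    exact congrFun h0 s
  obtain ⟨i, hi⟩ := hex_i
  have hinj_i : ∀ f ∈ P₀, p i f = 0 → f = 0 :=
    (forall_eq_zero_or_injOn_of_minimal (G := G) hP₀st hP₀min (p i) (fun g f _ => hpg i f g)).resolve_left
      fun hall => hi (hall f₀ hf₀)
  -- a slot `j` of `c'` with `q_j ∘ T` injective on `P₀`
  have hqT : ∀ j, ∀ g : G, ∀ f ∈ P₀, (q j ∘ₗ T) (fun x => f (g • x)) = fun s => (q j ∘ₗ T) f (g • s) :=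
    fun j g f hf => by
      rw [LinearMap.comp_apply, LinearMap.comp_apply, hT g f (hP₀P hf), ← hqg]
  have hex_j : ∃ j, ¬∀ f ∈ P₀, (q j ∘ₗ T) f = 0 := by
    by_contra hall
    push Not at hall
    apply hf₀0
    refine hTinj f₀ (hP₀P hf₀) ?_
    funext y
    obtain ⟨j, s⟩ := y
    exact congrFun (hall j f₀ hf₀) s
  obtain ⟨j, hj⟩ := hex_j
  have hinj_j : ∀ f ∈ P₀, (q j ∘ₗ T) f = 0 → f = 0 :=
    (forall_eq_zero_or_injOn_of_minimal (G := G) hP₀st hP₀min (q j ∘ₗ T) (hqT j)).resolve_left hj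
  -- the slots `i`, `j` lie in different blocks
  have hij : κ i.1 ≠ κ j.1 := by rw [i.2, j.2]; exact hcc'
  -- `T_i = q_j ∘ T ∘ (p_i|_{P₀})⁻¹`, extended to `ℚ^{E_i}`
  have hinjr : Function.Injective ((p i).domRestrict P₀) := by
    intro f f' hff'
    apply Subtype.ext
    have h0 : p i ((f : (Σ i : {i // κ i = c}, E i.1) → ℚ) - f') = 0 := by
      rw [map_sub, sub_eq_zero]
      exact hff'
    exact sub_eq_zero.1 (hinj_i _ (P₀.sub_mem f.2 f'.2) h0)
  obtain ⟨Ti, hTi⟩ := LinearMap.exists_extend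
    (((q j ∘ₗ T).domRestrict P₀) ∘ₗ (LinearEquiv.ofInjective ((p i).domRestrict P₀) hinjr).symm.toLinearMap)
  have hTic : ∀ f : P₀, Ti (p i f) = q j (T f) := fun f => by
    have h1 := LinearMap.congr_fun hTi (LinearEquiv.ofInjective ((p i).domRestrict P₀) hinjr f)
    simpa only [LinearMap.comp_apply, Submodule.coe_subtype, LinearEquiv.coe_toLinearMap,
      LinearEquiv.symm_apply_apply, LinearMap.domRestrict_apply, LinearEquiv.ofInjective_apply] using h1
  have hmemPi : ∀ a, a ∈ LinearMap.range ((p i).domRestrict P₀) ↔ ∃ f ∈ P₀, p i f = a := fun a => by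
    rw [LinearMap.mem_range]
    constructor
    · rintro ⟨f, rfl⟩
      exact ⟨f, f.2, rfl⟩
    · rintro ⟨f, hf, rfl⟩
      exact ⟨⟨f, hf⟩, rfl⟩
  -- the slot criterion kills `P_i = p_i(P₀)`
  have hPi0 : LinearMap.range ((p i).domRestrict P₀) = ⊥ := by
    refine hpair i.1 j.1 hij _ ?_ ?_ Ti ?_ ?_ ?_
    · intro a ha
      obtain ⟨f, hf, rfl⟩ := (hmemPi a).1 ha
      exact hpU i f (hP (hP₀P hf))
    · intro g a ha
      obtain ⟨f, hf, rfl⟩ := (hmemPi a).1 ha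
      refine (hmemPi _).2 ⟨fun x => f (g • x), hP₀st g f hf, ?_⟩
      rw [hpg]
    · intro g a ha
      obtain ⟨f, hf, rfl⟩ := (hmemPi a).1 ha
      have h1 := hTic ⟨f, hf⟩
      have h2 := hTic ⟨fun x => f (g • x), hP₀st g f hf⟩
      simp only at h1 h2
      rw [hpg] at h2
      rw [h2, h1, hT g f (hP₀P hf), ← hqg]
    · intro a ha
      obtain ⟨f, hf, rfl⟩ := (hmemPi a).1 ha
      have h1 := hTic ⟨f, hf⟩
      simp only at h1
      rw [h1]
      exact hqU j (T f) (hTU f (hP₀P hf))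
    · intro a ha ha0
      obtain ⟨f, hf, rfl⟩ := (hmemPi a).1 ha
      have h1 := hTic ⟨f, hf⟩
      simp only at h1
      rw [h1] at ha0
      rw [hinj_j f hf ha0, map_zero]
  have hfi : p i f₀ ∈ LinearMap.range ((p i).domRestrict P₀) := (hmemPi _).2 ⟨f₀, hf₀, rfl⟩
  rw [hPi0, Submodule.mem_bot] at hfi
  exact hi hfi

variable [Fintype C] [Nonempty I] [∀ i, Nonempty (E i)]

/-- **Rank additivity over the blocks from the slot criterion across blocks**: if no two slots of different blocks
share a constituent, then `rank(Σ) + |C| = Σ_c rank(Σ|_c) + 1` — `Hg(∏_i A_i) = ∏_c Hg(∏_{κ i = c} A_i)`.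
[cite: Gordon1999HodgeAVSurvey, §3 Theorem (1) (proof)] [cite: MoonenZarhin1999LowDim, §3 (3.1)] -/
theorem typeRank_sigmaType_add_card_eq_of_pairwise_slots_fiber {ρ : G} {Φ : ∀ i, Set (E i)}
    (h : ∀ i, IsCMTypeWith ρ (Φ i)) (κ : I → C) (hκ : Function.Surjective κ)
    (hpair : ∀ i j, κ i ≠ κ j → ∀ P : Submodule ℚ (E i → ℚ), P ≤ antiSpan G (Φ i) →
      (∀ g : G, ∀ f ∈ P, (fun x => f (g • x)) ∈ P) →
      ∀ T : (E i → ℚ) →ₗ[ℚ] (E j → ℚ),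
        (∀ g : G, ∀ f ∈ P, T (fun x => f (g • x)) = fun y => T f (g • y)) →
        (∀ f ∈ P, T f ∈ antiSpan G (Φ j)) → (∀ f ∈ P, T f = 0 → f = 0) → P = ⊥) :
    typeRank G (sigmaType Φ) + Fintype.card C =
      (∑ c, typeRank G (sigmaType fun i : {i // κ i = c} => Φ i.1)) + 1 :=
  typeRank_sigmaType_add_card_eq_of_pairwise_fiber h κ hκ (pairwise_fiber_of_pairwise_slots κ hpair)

/-- **Nondegeneracy is decided block by block under the slot criterion across blocks**: if no two slots of different
blocks share a constituent, then `rank(Σ) = |⊔_i E_i|/2 + 1 ⟺ ∀ c, rank(Σ|_c) = |⊔_{κ i = c} E_i|/2 + 1` (`∏_i A_i` is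
stably nondegenerate iff every `∏_{κ i = c} A_i` is). [cite: Gordon1999HodgeAVSurvey, §3 Theorem and 7.5]
[cite: MoonenZarhin1999LowDim, §3 (3.1)] -/
theorem typeRank_sigmaType_eq_iff_forall_fiber_of_pairwise_slots {ρ : G} {Φ : ∀ i, Set (E i)}
    (h : ∀ i, IsCMTypeWith ρ (Φ i)) (κ : I → C) (hκ : Function.Surjective κ)
    (hpair : ∀ i j, κ i ≠ κ j → ∀ P : Submodule ℚ (E i → ℚ), P ≤ antiSpan G (Φ i) →
      (∀ g : G, ∀ f ∈ P, (fun x => f (g • x)) ∈ P) →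
      ∀ T : (E i → ℚ) →ₗ[ℚ] (E j → ℚ),
        (∀ g : G, ∀ f ∈ P, T (fun x => f (g • x)) = fun y => T f (g • y)) →
        (∀ f ∈ P, T f ∈ antiSpan G (Φ j)) → (∀ f ∈ P, T f = 0 → f = 0) → P = ⊥) :
    typeRank G (sigmaType Φ) = Fintype.card (Σ i, E i) / 2 + 1 ↔
      ∀ c, typeRank G (sigmaType fun i : {i // κ i = c} => Φ i.1) =
        Fintype.card (Σ i : {i // κ i = c}, E i.1) / 2 + 1 :=
  typeRank_sigmaType_eq_iff_forall_fiber_of_pairwise h κ hκ (pairwise_fiber_of_pairwise_slots κ hpair)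

end SlotsToBlocks

end Literature.NumberTheory.ComplexMultiplication

end
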